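import Summits.QuantumFields.YangMills.Theorems.SwapVirialDeficitZeroModeSigmaFourSmallBallDominatorIntegral
import Literature.MathematicalPhysics.QuantumLattice.SU2HaarChart
import HarnessLib

/-!
# Exact zero-mode rung Z5 — the σ-TWISTED FOUR-LEADER small ball, IV-c: the hub integral of the dominator is finite
# (LEAD ym-line-sfw-p2 g93 07:46Z «`Haar⁴{E_σ(t)} = v₇t⁷(1 + O(t^θ))`»; free-hands support of ⟨stmt-QuantumFields-24197⟩)

Part IV-b bounded the three-letter integral of the dominator by `64e⁴·K(α,β)·I(1/3)²` at an axial hub unit `A = (α, β, 0, 0)` with `αβ ≠ 0`,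
`K(α,β) = (π²/12)(β²)⁻¹(α²β²)^{−1/3}`.  At the hub `a` of the cone model `A = radialUnit (axisPoint a)`: `α = a₀/‖a‖`, `β = ‖Im a‖/‖a‖`, so on the
unit ball `K ≤ (π²/12)·(a₀²)^{−1/3}·(‖Im a‖²)^{−4/3}` (`hubK_axis_le`).  By AM–GM (✓`ZeroModeGroup.hub_bound`) `(‖Im a‖²)^{−4/3} ≤ 3^{−4/3}Π_c (a_c²)^{−4/9}`,
so the cone integral of the hub weight is at most `coneConst·3^{−4/3}·I(1/3)·I(4/9)³ < ∞` (✓`Ising_lt_top`): ★ `lintegral_cone_hubW_lt_top`.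
Assembled: ★★ `lintegral_cone_vol_sigmaDom_ne_top` — the `t`-free dominator of the rescaled σ-events is integrable against `cone ⊗ vol³`;
with part IV-a this is the domination hypothesis of the dominated-convergence step (part V).  No logarithm anywhere: the torus stratum of
`Hom(ℤ³ ⋊_σ ℤ, SU(2))` is a regular (RLCT `7/2`, multiplicity one) zero-mode block, as LEAD g93's shells predicted.
HONEST LABEL: finite-dimensional measure theory on `SU(2)⁴` (plan-level zero-mode rung of the DRAFT line «sharp-sigma»); NOT the fixed-`L` sharp law,
NOT ⟨24197⟩; own crux ⟨22884⟩ OPEN (blocked-on ⟨19935⟩); the Yang–Mills mass gap is NOT proved; no summit is proved by a line.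
Width seat ym-line-sfw-p2-w3 g63 (cell ym-idea-1, free hands), `--supports stmt-QuantumFields-24197`.  Standard axioms, 0 `sorry`.
References: [cite: GonzalezarroyoAltes1988]; [cite: Vanbaal2001]; [cite: Luscher1983, §2]; [folklore].
-/

set_option autoImplicit false

noncomputable section

open MeasureTheory Quaternion Set
open scoped Quaternion ENNReal BigOperators
open Literature.MathematicalPhysics.QuantumLattice
open Literature.Analysis.Calculus (radialUnit radialUnit_def norm_radialUnit)
open Summit.QuantumFields.YangMills.Theorems.SwapTwistDeficit.ToronLog
open Summit.QuantumFields.YangMills.Theorems.ToronValleyVolume.NearlyCommutingCeiling (sq_norm_im_eq)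
open Summit.QuantumFields.YangMills.Theorems.SwapVirialDeficit.ZeroModeGroup

attribute [local instance] Literature.Analysis.FluidPDE.Tao2016.quatMeasurableSpace
  Literature.Analysis.FluidPDE.Tao2016.quatBorelSpace
  Literature.MathematicalPhysics.QuantumLattice.secondCountableTopology_su2

namespace Summit.QuantumFields.YangMills.Theorems.SwapVirialDeficit.ZeroModeSigma

/-! ## §20 The hub constant on the unit ball -/

/-- Squared coordinates of the axial hub unit: `α² = a₀²/‖a‖²`, `β² = ‖Im a‖²/‖a‖²`. [folklore] -/
theorem axisUnit_sq (a : ℍ) :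
    (radialUnit (axisPoint a)).re ^ 2 = a.re ^ 2 / ‖a‖ ^ 2 ∧ (radialUnit (axisPoint a)).imI ^ 2 = ‖a.im‖ ^ 2 / ‖a‖ ^ 2 := by
  obtain ⟨hre, hI, -, -⟩ := radialUnit_components (axisPoint a)
  have hc := axisPoint_components a
  rw [hre, hI, hc.1, hc.2.1, norm_axisPoint]
  constructor <;> rw [mul_pow, inv_pow, inv_mul_eq_div]

/-- ★ **The hub constant on the unit ball**: for `0 < ‖a‖ ≤ 1`, `a₀ ≠ 0`, `Im a ≠ 0`,
`K(α(a), β(a)) ≤ (π²/12)·(a₀²)^{−1/3}·(‖Im a‖²)^{−4/3}`. [folklore] -/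
theorem hubK_axis_le {a : ℍ} (ha1 : ‖a‖ ≤ 1) (hre : a.re ≠ 0) (him : a.im ≠ 0) :
    hubK (radialUnit (axisPoint a)).re (radialUnit (axisPoint a)).imI ≤
      Real.pi ^ 2 / 12 * ((a.re ^ 2) ^ (-(1/3 : ℝ)) * (‖a.im‖ ^ 2) ^ (-(4/3 : ℝ))) := by
  obtain ⟨eR, eM⟩ := axisUnit_sq a
  have ha0 : a ≠ 0 := by intro h; rw [h] at hre; exact hre rfl
  have hN : 0 < ‖a‖ ^ 2 := by positivity
  have hR : 0 < a.re ^ 2 := by positivity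
  have hM : 0 < ‖a.im‖ ^ 2 := by have := norm_pos_iff.2 him; positivity
  have hN1 : ‖a‖ ^ 2 ≤ 1 := by nlinarith [norm_nonneg a]
  rw [hubK, eR, eM, mul_assoc]
  refine mul_le_mul_of_nonneg_left ?_ (by positivity)
  -- `(M/N)⁻¹ · ((R/N)(M/N))^{-1/3} = N·N^{2/3} · R^{-1/3} · M^{-4/3} ≤ R^{-1/3} M^{-4/3}`
  have e1 : (‖a.im‖ ^ 2 / ‖a‖ ^ 2)⁻¹ = ‖a‖ ^ 2 * (‖a.im‖ ^ 2)⁻¹ := by rw [inv_div, div_eq_mul_inv]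
  have e2 : (a.re ^ 2 / ‖a‖ ^ 2 * (‖a.im‖ ^ 2 / ‖a‖ ^ 2)) ^ (-(1/3 : ℝ)) =
      (a.re ^ 2) ^ (-(1/3 : ℝ)) * (‖a.im‖ ^ 2) ^ (-(1/3 : ℝ)) * ((‖a‖ ^ 2 * ‖a‖ ^ 2) ^ (-(1/3 : ℝ)))⁻¹ := by
    rw [show a.re ^ 2 / ‖a‖ ^ 2 * (‖a.im‖ ^ 2 / ‖a‖ ^ 2) = (a.re ^ 2 * ‖a.im‖ ^ 2) / (‖a‖ ^ 2 * ‖a‖ ^ 2) by ring,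
      Real.div_rpow (by positivity) (by positivity), Real.mul_rpow hR.le hM.le, div_eq_mul_inv]
  have e3 : (‖a.im‖ ^ 2) ^ (-(4/3 : ℝ)) = (‖a.im‖ ^ 2) ^ (-(1/3 : ℝ)) * (‖a.im‖ ^ 2)⁻¹ := by
    rw [← Real.rpow_neg_one, ← Real.rpow_add hM]; norm_num
  rw [e1, e2, e3]
  -- the `‖a‖`-factor is `≤ 1`
  have hNN : 0 < ‖a‖ ^ 2 * ‖a‖ ^ 2 := by positivity
  have hfac : ‖a‖ ^ 2 * ((‖a‖ ^ 2 * ‖a‖ ^ 2) ^ (-(1/3 : ℝ)))⁻¹ ≤ 1 := by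
    rw [Real.rpow_neg hNN.le, inv_inv]
    have h1 : (‖a‖ ^ 2 * ‖a‖ ^ 2) ^ ((1/3 : ℝ)) ≤ 1 := Real.rpow_le_one hNN.le (by nlinarith) (by norm_num)
    have h2 : 0 ≤ (‖a‖ ^ 2 * ‖a‖ ^ 2) ^ ((1/3 : ℝ)) := Real.rpow_nonneg hNN.le _
    nlinarith
  have hX : 0 ≤ (a.re ^ 2) ^ (-(1/3 : ℝ)) * (‖a.im‖ ^ 2) ^ (-(1/3 : ℝ)) * (‖a.im‖ ^ 2)⁻¹ := by positivity
  calc ‖a‖ ^ 2 * (‖a.im‖ ^ 2)⁻¹ * ((a.re ^ 2) ^ (-(1/3 : ℝ)) * (‖a.im‖ ^ 2) ^ (-(1/3 : ℝ)) * ((‖a‖ ^ 2 * ‖a‖ ^ 2) ^ (-(1/3 : ℝ)))⁻¹)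
      = (‖a‖ ^ 2 * ((‖a‖ ^ 2 * ‖a‖ ^ 2) ^ (-(1/3 : ℝ)))⁻¹) * ((a.re ^ 2) ^ (-(1/3 : ℝ)) * (‖a.im‖ ^ 2) ^ (-(1/3 : ℝ)) * (‖a.im‖ ^ 2)⁻¹) := by
        ring
    _ ≤ 1 * ((a.re ^ 2) ^ (-(1/3 : ℝ)) * (‖a.im‖ ^ 2) ^ (-(1/3 : ℝ)) * (‖a.im‖ ^ 2)⁻¹) := mul_le_mul_of_nonneg_right hfac hX
    _ = (a.re ^ 2) ^ (-(1/3 : ℝ)) * ((‖a.im‖ ^ 2) ^ (-(1/3 : ℝ)) * (‖a.im‖ ^ 2)⁻¹) := by ring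

/-! ## §21 The hub weight and its cone integral -/

/-- **The hub weight** `(a₀²)^{−1/3}·(‖Im a‖²)^{−4/3}` with value `⊤` on the null set `{a₀ = 0} ∪ {Im a = 0}`. [folklore] -/
def hubW (a : ℍ) : ℝ≥0∞ := singPow (1/3) a.re * singPow (4/3) ‖a.im‖

/-- Unfolding `hubW`. [folklore] -/
theorem hubW_def (a : ℍ) : hubW a = singPow (1/3) a.re * singPow (4/3) ‖a.im‖ := rfl

/-- Off the null set, `hubW a = (a₀²)^{−1/3}·(‖Im a‖²)^{−4/3}`. [folklore] -/
theorem hubW_of_ne {a : ℍ} (hre : a.re ≠ 0) (him : a.im ≠ 0) :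
    hubW a = ENNReal.ofReal ((a.re ^ 2) ^ (-(1/3 : ℝ)) * (‖a.im‖ ^ 2) ^ (-(4/3 : ℝ))) := by
  rw [hubW, singPow_of_ne hre, singPow_of_ne (norm_ne_zero_iff.2 him), ← ENNReal.ofReal_mul (Real.rpow_nonneg (sq_nonneg _) _)]

/-- `hubW` is measurable. [folklore] -/
theorem measurable_hubW : Measurable hubW := by
  unfold hubW
  exact ((measurable_singPow _).comp measurable_quat_re).mul ((measurable_singPow _).comp (measurable_quat_im.norm))

/-- ★ ENNReal form of the hub bound (valid for every `a` in the closed unit ball, `⊤` on the null set). [folklore] -/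
theorem ofReal_hubK_axis_le {a : ℍ} (ha1 : ‖a‖ ≤ 1) :
    ENNReal.ofReal (hubK (radialUnit (axisPoint a)).re (radialUnit (axisPoint a)).imI) ≤ ENNReal.ofReal (Real.pi ^ 2 / 12) * hubW a := by
  have hKne : ENNReal.ofReal (Real.pi ^ 2 / 12) ≠ 0 := (ENNReal.ofReal_pos.2 (by positivity)).ne'
  by_cases hre : a.re = 0
  · rw [hubW, hre, singPow_zero, ENNReal.top_mul (singPow_ne_zero _ _), ENNReal.mul_top hKne]; exact le_top
  by_cases him : a.im = 0
  · rw [hubW, him, norm_zero, singPow_zero, ENNReal.mul_top (singPow_ne_zero _ _), ENNReal.mul_top hKne]; exact le_top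
  rw [hubW_of_ne hre him, ← ENNReal.ofReal_mul (by positivity)]
  exact ENNReal.ofReal_le_ofReal (hubK_axis_le ha1 hre him)

/-- ★ **The hub weight is integrable on the unit ball**: `∫ 𝟙_B·hubW dvol ≤ 3^{−4/3}·I(1/3)·I(4/9)³ < ∞` (AM–GM on `‖Im a‖²`, ✓`hub_bound`). [folklore] -/
theorem lintegral_ball_hubW_lt_top : ∫⁻ a : ℍ, (Metric.ball (0:ℍ) 1).indicator hubW a < ∞ := by
  set B : Set (ℝ × (ℝ × (ℝ × ℝ))) := {p | p.1 ^ 2 + p.2.1 ^ 2 + p.2.2.1 ^ 2 + p.2.2.2 ^ 2 < 1} with hB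
  set f : ℝ × (ℝ × (ℝ × ℝ)) → ℝ≥0∞ := fun p => B.indicator
      (fun p => singPow (1/3) p.1 * singPow (4/3) (Real.sqrt (p.2.1 ^ 2 + p.2.2.1 ^ 2 + p.2.2.2 ^ 2))) p with hf
  have hBm : MeasurableSet B := measurableSet_lt (by fun_prop) measurable_const
  have hfm : Measurable f :=
    (((measurable_singPow _).comp measurable_fst).mul ((measurable_singPow _).comp
      ((by fun_prop : Measurable fun p : ℝ × (ℝ × (ℝ × ℝ)) => p.2.1 ^ 2 + p.2.2.1 ^ 2 + p.2.2.2 ^ 2).sqrt))).indicator hBm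
  have him_eq : ∀ a : ℍ, ‖a.im‖ = Real.sqrt (a.imI ^ 2 + a.imJ ^ 2 + a.imK ^ 2) := by
    intro a
    have h : ‖a.im‖ ^ 2 = a.imI ^ 2 + a.imJ ^ 2 + a.imK ^ 2 := by rw [sq_norm_eq_sum_sq]; simp
    rw [← h, Real.sqrt_sq (norm_nonneg _)]
  have he : ∀ a : ℍ, (Metric.ball (0:ℍ) 1).indicator hubW a = f (coord4 a) := by
    intro a
    have hmem : a ∈ Metric.ball (0:ℍ) 1 ↔ coord4 a ∈ B := by
      show a ∈ Metric.ball (0:ℍ) 1 ↔ a.re ^ 2 + a.imI ^ 2 + a.imJ ^ 2 + a.imK ^ 2 < 1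
      rw [Metric.mem_ball, dist_zero_right, ← sq_norm_eq_sum_sq, pow_lt_one_iff_of_nonneg (norm_nonneg _) two_ne_zero]
    simp only [hf]
    by_cases hm : a ∈ Metric.ball (0:ℍ) 1
    · rw [indicator_of_mem hm, indicator_of_mem (hmem.1 hm), hubW, him_eq]; rfl
    · rw [indicator_of_notMem hm, indicator_of_notMem (fun h => hm (hmem.2 h))]
  rw [lintegral_congr he, measurePreserving_coord4.lintegral_comp hfm]
  have hC : ENNReal.ofReal ((3:ℝ) ^ (-(4/3 : ℝ))) ≠ 0 := (ENNReal.ofReal_pos.2 (Real.rpow_pos_of_pos (by norm_num) _)).ne'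
  have hbd : ∀ p, f p ≤ ENNReal.ofReal ((3:ℝ) ^ (-(4/3 : ℝ))) * ({u : ℝ | u ^ 2 < 1}.indicator (singPow (1/3)) p.1 *
      ({u : ℝ | u ^ 2 < 1}.indicator (singPow (4/9)) p.2.1 * ({u : ℝ | u ^ 2 < 1}.indicator (singPow (4/9)) p.2.2.1 *
        {u : ℝ | u ^ 2 < 1}.indicator (singPow (4/9)) p.2.2.2))) := by
    intro p
    by_cases hm : p ∈ B
    swap
    · simp only [hf]; rw [indicator_of_notMem hm]; exact bot_le
    have hm' : p.1 ^ 2 + p.2.1 ^ 2 + p.2.2.1 ^ 2 + p.2.2.2 ^ 2 < 1 := hm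
    have h0 : p.1 ∈ {u : ℝ | u ^ 2 < 1} := by
      show p.1 ^ 2 < 1; nlinarith [sq_nonneg p.2.1, sq_nonneg p.2.2.1, sq_nonneg p.2.2.2]
    have h1 : p.2.1 ∈ {u : ℝ | u ^ 2 < 1} := by
      show p.2.1 ^ 2 < 1; nlinarith [sq_nonneg p.1, sq_nonneg p.2.2.1, sq_nonneg p.2.2.2]
    have h2 : p.2.2.1 ∈ {u : ℝ | u ^ 2 < 1} := by
      show p.2.2.1 ^ 2 < 1; nlinarith [sq_nonneg p.1, sq_nonneg p.2.1, sq_nonneg p.2.2.2]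
    have h3 : p.2.2.2 ∈ {u : ℝ | u ^ 2 < 1} := by
      show p.2.2.2 ^ 2 < 1; nlinarith [sq_nonneg p.1, sq_nonneg p.2.1, sq_nonneg p.2.2.1]
    simp only [hf]
    rw [indicator_of_mem hm, indicator_of_mem h0, indicator_of_mem h1, indicator_of_mem h2, indicator_of_mem h3]
    -- singular cases: some coordinate vanishes ⇒ the right-hand side is `⊤`
    by_cases z0 : p.1 = 0
    · rw [z0, singPow_zero, ENNReal.top_mul (mul_ne_zero (singPow_ne_zero _ _) (mul_ne_zero (singPow_ne_zero _ _) (singPow_ne_zero _ _))),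
        ENNReal.mul_top hC]
      exact le_top
    by_cases z1 : p.2.1 = 0
    · rw [z1, singPow_zero, ENNReal.top_mul (mul_ne_zero (singPow_ne_zero _ _) (singPow_ne_zero _ _)), ENNReal.mul_top (singPow_ne_zero _ _),
        ENNReal.mul_top hC]
      exact le_top
    by_cases z2 : p.2.2.1 = 0
    · rw [z2, singPow_zero, ENNReal.top_mul (singPow_ne_zero _ _), ENNReal.mul_top (singPow_ne_zero _ _), ENNReal.mul_top (singPow_ne_zero _ _),
        ENNReal.mul_top hC]
      exact le_top
    by_cases z3 : p.2.2.2 = 0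
    · rw [z3, singPow_zero, ENNReal.mul_top (singPow_ne_zero _ _), ENNReal.mul_top (singPow_ne_zero _ _), ENNReal.mul_top (singPow_ne_zero _ _),
        ENNReal.mul_top hC]
      exact le_top
    -- regular case
    have hS : 0 < p.2.1 ^ 2 + p.2.2.1 ^ 2 + p.2.2.2 ^ 2 := by positivity
    have hsq : Real.sqrt (p.2.1 ^ 2 + p.2.2.1 ^ 2 + p.2.2.2 ^ 2) ≠ 0 := (Real.sqrt_pos.2 hS).ne'
    rw [singPow_of_ne z0, singPow_of_ne hsq, singPow_of_ne z1, singPow_of_ne z2, singPow_of_ne z3, Real.sq_sqrt hS.le,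
      ← ENNReal.ofReal_mul (Real.rpow_nonneg (sq_nonneg _) _), ← ENNReal.ofReal_mul (Real.rpow_nonneg (sq_nonneg _) _),
      ← ENNReal.ofReal_mul (Real.rpow_nonneg (sq_nonneg _) _), ← ENNReal.ofReal_mul (Real.rpow_nonneg (sq_nonneg _) _),
      ← ENNReal.ofReal_mul (Real.rpow_nonneg (by norm_num) _)]
    refine ENNReal.ofReal_le_ofReal ?_
    have hb := hub_bound z1 z2 z3
    have h0' : 0 ≤ (p.1 ^ 2) ^ (-(1/3 : ℝ)) := Real.rpow_nonneg (sq_nonneg _) _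
    calc (p.1 ^ 2) ^ (-(1/3 : ℝ)) * (p.2.1 ^ 2 + p.2.2.1 ^ 2 + p.2.2.2 ^ 2) ^ (-(4/3 : ℝ))
        ≤ (p.1 ^ 2) ^ (-(1/3 : ℝ)) * ((3:ℝ) ^ (-(4/3 : ℝ)) * ((p.2.1 ^ 2) ^ (-(4/9 : ℝ)) * (p.2.2.1 ^ 2) ^ (-(4/9 : ℝ)) * (p.2.2.2 ^ 2) ^ (-(4/9 : ℝ)))) :=
          mul_le_mul_of_nonneg_left hb h0'
      _ = _ := by ring
  have hm3 : Measurable fun v : ℝ × ℝ => {u : ℝ | u ^ 2 < 1}.indicator (singPow (4/9)) v.1 * {u : ℝ | u ^ 2 < 1}.indicator (singPow (4/9)) v.2 :=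
    ((measurable_boxSing _).comp measurable_fst).mul ((measurable_boxSing _).comp measurable_snd)
  have hm2 : Measurable fun u : ℝ × (ℝ × ℝ) => {u : ℝ | u ^ 2 < 1}.indicator (singPow (4/9)) u.1 *
      ({u : ℝ | u ^ 2 < 1}.indicator (singPow (4/9)) u.2.1 * {u : ℝ | u ^ 2 < 1}.indicator (singPow (4/9)) u.2.2) :=
    ((measurable_boxSing _).comp measurable_fst).mul (hm3.comp measurable_snd)
  have hm1 : Measurable fun p : ℝ × (ℝ × (ℝ × ℝ)) => {u : ℝ | u ^ 2 < 1}.indicator (singPow (1/3)) p.1 *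
      ({u : ℝ | u ^ 2 < 1}.indicator (singPow (4/9)) p.2.1 * ({u : ℝ | u ^ 2 < 1}.indicator (singPow (4/9)) p.2.2.1 *
        {u : ℝ | u ^ 2 < 1}.indicator (singPow (4/9)) p.2.2.2)) :=
    ((measurable_boxSing _).comp measurable_fst).mul (hm2.comp measurable_snd)
  have hI := Ising_lt_top (c := 4/9) (by norm_num) (by norm_num)
  have hI3 := Ising_lt_top (c := 1/3) (by norm_num) (by norm_num)
  calc ∫⁻ p, f p ≤ ∫⁻ p : ℝ × (ℝ × (ℝ × ℝ)), ENNReal.ofReal ((3:ℝ) ^ (-(4/3 : ℝ))) * ({u : ℝ | u ^ 2 < 1}.indicator (singPow (1/3)) p.1 *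
      ({u : ℝ | u ^ 2 < 1}.indicator (singPow (4/9)) p.2.1 * ({u : ℝ | u ^ 2 < 1}.indicator (singPow (4/9)) p.2.2.1 *
        {u : ℝ | u ^ 2 < 1}.indicator (singPow (4/9)) p.2.2.2))) := lintegral_mono hbd
    _ = ENNReal.ofReal ((3:ℝ) ^ (-(4/3 : ℝ))) * (Ising (1/3) * (Ising (4/9) * (Ising (4/9) * Ising (4/9)))) := by
        rw [lintegral_const_mul _ hm1, lintegral_volume_prod_mul (measurable_boxSing _) hm2,
          lintegral_volume_prod_mul (measurable_boxSing _) hm3, lintegral_volume_prod_mul (measurable_boxSing _) (measurable_boxSing _)]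
        rfl
    _ < ∞ := ENNReal.mul_lt_top ENNReal.ofReal_lt_top (ENNReal.mul_lt_top hI3 (ENNReal.mul_lt_top hI (ENNReal.mul_lt_top hI hI)))

/-- ★ The hub weight is `coneMeasure`-integrable. [folklore] -/
theorem lintegral_cone_hubW_lt_top : ∫⁻ a, hubW a ∂coneMeasure < ∞ := by
  rw [lintegral_coneMeasure_eq]
  exact ENNReal.mul_lt_top ENNReal.ofReal_lt_top lintegral_ball_hubW_lt_top

/-! ## §22 The dominator is integrable against `cone ⊗ vol³` -/

/-- For `cone`-almost every hub: `a₀ ≠ 0`, `Im a ≠ 0`, `‖a‖ < 1`. [folklore] -/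
theorem ae_cone_hub_good : ∀ᵐ a ∂coneMeasure, a.re ≠ 0 ∧ a.im ≠ 0 ∧ ‖a‖ < 1 := by
  have h1 : ∀ᵐ a ∂coneMeasure, a.re ≠ 0 := by
    have h : ∀ᵐ a ∂(volume : Measure ℍ), a.re ≠ 0 := by
      rw [ae_iff]; simpa only [ne_eq, not_not] using Literature.MathematicalPhysics.QuantumLattice.volume_re_eq_zero
    unfold coneMeasure; exact Measure.ae_smul_measure (ae_restrict_of_ae h) _
  have h2 : ∀ᵐ a ∂coneMeasure, a.im ≠ 0 := by
    filter_upwards [ae_cone_imJ_ne_zero] with a ha using (norm_pos_iff.1 (norm_im_pos_of_imJ_ne_zero ha))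
  have h3 : ∀ᵐ a ∂coneMeasure, ‖a‖ < 1 := by
    have h : ∀ᵐ a ∂((volume : Measure ℍ).restrict (Metric.ball 0 1)), ‖a‖ < 1 := by
      filter_upwards [ae_restrict_mem measurableSet_ball] with a ha
      simpa [Metric.mem_ball, dist_zero_right] using ha
    unfold coneMeasure; exact Measure.ae_smul_measure h _
  filter_upwards [h1, h2, h3] with a ha hb hc using ⟨ha, hb, hc⟩

/-- The dominator at the hub of the cone model, `(a, w) ↦ sigmaDom (radialUnit (axisPoint a)) w`, is jointly measurable. [folklore] -/
theorem measurable_sigmaDom_hub : Measurable fun q : ℍ × ((ℍ × ℍ) × ℍ) => sigmaDom (radialUnit (axisPoint q.1)) q.2 := by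
  have hA : Measurable fun q : ℍ × ((ℍ × ℍ) × ℍ) => radialUnit (axisPoint q.1) := measurable_axisUnit.comp measurable_fst
  have hAre : Measurable fun q : ℍ × ((ℍ × ℍ) × ℍ) => (radialUnit (axisPoint q.1)).re := measurable_quat_re.comp hA
  have hAI : Measurable fun q : ℍ × ((ℍ × ℍ) × ℍ) => (radialUnit (axisPoint q.1)).imI := measurable_quat_imI.comp hA
  have hx : Measurable fun q : ℍ × ((ℍ × ℍ) × ℍ) => q.2.1.1 := measurable_fst.comp (measurable_fst.comp measurable_snd)
  have hy : Measurable fun q : ℍ × ((ℍ × ℍ) × ℍ) => q.2.1.2 := measurable_snd.comp (measurable_fst.comp measurable_snd)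
  have hz : Measurable fun q : ℍ × ((ℍ × ℍ) × ℍ) => q.2.2 := measurable_snd.comp measurable_snd
  have hq : Measurable fun q : ℍ × ((ℍ × ℍ) × ℍ) => qLoad (radialUnit (axisPoint q.1)) q.2.1.1 q.2.1.2 := by
    have e : (fun q : ℍ × ((ℍ × ℍ) × ℍ) => qLoad (radialUnit (axisPoint q.1)) q.2.1.1 q.2.1.2) = fun q =>
        4 * ((q.2.1.1.imK * q.2.1.2.imI - q.2.1.1.imI * q.2.1.2.imK) ^ 2 + (q.2.1.1.imI * q.2.1.2.imJ - q.2.1.1.imJ * q.2.1.2.imI) ^ 2) +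
        4 * ((radialUnit (axisPoint q.1)).imI ^ 2 * (q.2.1.2.imJ ^ 2 + q.2.1.2.imK ^ 2)) +
        (radialUnit (axisPoint q.1)).re ^ 2 * (radialUnit (axisPoint q.1)).imI ^ 2 * (q.2.1.1.imJ ^ 2 + q.2.1.1.imK ^ 2) +
        16 / 9 * ((radialUnit (axisPoint q.1)).imI ^ 2 * q.2.1.1.imI ^ 2 * (q.2.1.1.imJ ^ 2 + q.2.1.1.imK ^ 2)) := by
      funext q; rw [qLoad_def]
    rw [e]
    have hxI := measurable_quat_imI.comp hx
    have hxJ := measurable_quat_imJ.comp hx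
    have hxK := measurable_quat_imK.comp hx
    have hyI := measurable_quat_imI.comp hy
    have hyJ := measurable_quat_imJ.comp hy
    have hyK := measurable_quat_imK.comp hy
    exact ((((((hxK.mul hyI).sub (hxI.mul hyK)).pow_const 2).add (((hxI.mul hyJ).sub (hxJ.mul hyI)).pow_const 2)).const_mul _).add
      (((hAI.pow_const 2).mul ((hyJ.pow_const 2).add (hyK.pow_const 2))).const_mul _)).add
      (((hAre.pow_const 2).mul (hAI.pow_const 2)).mul ((hxJ.pow_const 2).add (hxK.pow_const 2))) |>.add
      ((((hAI.pow_const 2).mul (hxI.pow_const 2)).mul ((hxJ.pow_const 2).add (hxK.pow_const 2))).const_mul _)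
  have e : (fun q : ℍ × ((ℍ × ℍ) × ℍ) => sigmaDom (radialUnit (axisPoint q.1)) q.2) = fun q =>
      axBox.indicator (fun _ => (1 : ℝ≥0∞)) q.2.1.1 * axBox.indicator (fun _ => (1 : ℝ≥0∞)) q.2.1.2 *
        zBox.indicator (fun _ => (1 : ℝ≥0∞)) q.2.2 * ENNReal.ofReal (Real.exp (4 - qLoad (radialUnit (axisPoint q.1)) q.2.1.1 q.2.1.2)) := by
    funext q; rw [sigmaDom_def]
  rw [e]
  exact ((((measurable_const.indicator measurableSet_axBox).comp hx).mul ((measurable_const.indicator measurableSet_axBox).comp hy)).mul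
    ((measurable_const.indicator measurableSet_zBox).comp hz)).mul (ENNReal.measurable_ofReal.comp (Real.measurable_exp.comp (measurable_const.sub hq)))

/-- ★★ **THE DOMINATOR IS INTEGRABLE against `cone ⊗ vol³`** (iterated form). [folklore] -/
theorem lintegral_cone_vol_sigmaDom_ne_top :
    ∫⁻ a, ∫⁻ w, sigmaDom (radialUnit (axisPoint a)) w ∂(((volume : Measure ℍ).prod volume).prod volume) ∂coneMeasure ≠ ∞ := by
  have hI := Ising_lt_top (c := 1/3) (by norm_num) (by norm_num)
  -- a.e. bound by the hub weight
  have hbd : ∀ᵐ a ∂coneMeasure, ∫⁻ w, sigmaDom (radialUnit (axisPoint a)) w ∂(((volume : Measure ℍ).prod volume).prod volume) ≤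
      (4 * (ENNReal.ofReal (Real.pi ^ 2 / 12) * (Ising (1/3) * Ising (1/3))) * (16 * ENNReal.ofReal (Real.exp 4))) * hubW a := by
    filter_upwards [ae_cone_hub_good] with a ha
    obtain ⟨hre, him, hn⟩ := ha
    have ha0 : a ≠ 0 := by intro h; rw [h] at hre; exact hre rfl
    obtain ⟨eR, eM⟩ := axisUnit_sq a
    have hN : 0 < ‖a‖ ^ 2 := by positivity
    have hα : (radialUnit (axisPoint a)).re ≠ 0 := by
      intro h0; rw [h0] at eR
      have : a.re ^ 2 / ‖a‖ ^ 2 = 0 := by rw [← eR]; ring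
      rw [div_eq_zero_iff] at this
      rcases this with h | h
      · exact hre (pow_eq_zero_iff two_ne_zero |>.1 h)
      · exact hN.ne' h
    have hβ : (radialUnit (axisPoint a)).imI ≠ 0 := by
      intro h0; rw [h0] at eM
      have : ‖a.im‖ ^ 2 / ‖a‖ ^ 2 = 0 := by rw [← eM]; ring
      rw [div_eq_zero_iff] at this
      rcases this with h | h
      · exact him (norm_eq_zero.1 (pow_eq_zero_iff two_ne_zero |>.1 h))
      · exact hN.ne' h
    have h1 := axial_sq_add_sq (norm_axisUnit ha0) (axisUnit_axial a).1 (axisUnit_axial a).2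
    have hmain := lintegral_sigmaDom_le h1 hα hβ
    have hK := ofReal_hubK_axis_le hn.le
    calc ∫⁻ w, sigmaDom (radialUnit (axisPoint a)) w ∂(((volume : Measure ℍ).prod volume).prod volume)
        ≤ 4 * (ENNReal.ofReal (hubK (radialUnit (axisPoint a)).re (radialUnit (axisPoint a)).imI) * (Ising (1/3) * Ising (1/3))) *
            (16 * ENNReal.ofReal (Real.exp 4)) := hmain
      _ ≤ 4 * ((ENNReal.ofReal (Real.pi ^ 2 / 12) * hubW a) * (Ising (1/3) * Ising (1/3))) * (16 * ENNReal.ofReal (Real.exp 4)) := by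
          gcongr
      _ = (4 * (ENNReal.ofReal (Real.pi ^ 2 / 12) * (Ising (1/3) * Ising (1/3))) * (16 * ENNReal.ofReal (Real.exp 4))) * hubW a := by ring
  refine ne_top_of_le_ne_top ?_ (lintegral_mono_ae hbd)
  rw [lintegral_const_mul _ measurable_hubW]
  exact ENNReal.mul_ne_top (ENNReal.mul_ne_top (ENNReal.mul_ne_top (by norm_num) (ENNReal.mul_ne_top ENNReal.ofReal_ne_top
    (ENNReal.mul_ne_top hI.ne hI.ne))) (ENNReal.mul_ne_top (by norm_num) ENNReal.ofReal_ne_top)) lintegral_cone_hubW_lt_top.ne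

/-- ★★ The same on the product measure `cone ⊗ vol³`. [folklore] -/
theorem lintegral_prod_sigmaDom_ne_top :
    ∫⁻ q, sigmaDom (radialUnit (axisPoint q.1)) q.2 ∂(coneMeasure.prod (((volume : Measure ℍ).prod volume).prod volume)) ≠ ∞ := by
  haveI := isProbabilityMeasure_coneMeasure
  rw [lintegral_prod _ measurable_sigmaDom_hub.aemeasurable]
  exact lintegral_cone_vol_sigmaDom_ne_top

end Summit.QuantumFields.YangMills.Theorems.SwapVirialDeficit.ZeroModeSigma

end
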